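import Mathlib

/-!
# STUB-IDEAS sketch k3-g45 — `stub_heegnerIndexLowerAtTwo` (crux `SplitBadTwoLowerHalfOfFacts`, stmt-BirchSwinnertonDyer-27851)

HONEST FRAMING: BSD is NOT proved by anything here; the crux and the stub are NOT proved here.
This file is the typed core of idea card `stub_heegnerIndexLowerAtTwo-k3` (family 3 «probe the
extremes»: minimal-counterexample / autopsy, technique «decomposition with a PROVED glue»).

THE HEEGNER-SHIFT LINT.  The plan of record (STUB-PLAN v7.9) books the LOWER half of BSD₂ for the
additive-at-2 CM twists `W` of `49a` in DIGITS (2-adic valuations):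
  `B = v₂ #Ш(W/K)[2^∞]`, `i = v₂ [W(K) : ℤP]` (Heegner index), `c = v₂ c_Dt`, `tam = v₂ Tam(W/K)`,
  `ℓ = v₂ log_ω P_gen`, `x = v₂ log_ω y_K = i + ℓ`, `v = v₂ (∫ r·θ̂⁻¹ dμ)` (the Katz value of record),
  `n = v₂ char(X)(point)` (two-variable main-conjecture side), `lam = v₂ λ` (position of the
  elliptic-unit class on the line `ℤ₂·P_gen`), `g, eC` (control digits), `κ` (key constant).
The stub's conclusion `2·v₂(index) − 2·v₂(c) ≤ v₂ #Ш[2^∞] + v₂ Tam` is `Lower` below.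
`shift t` moves ONLY the Heegner data `i ↦ i + t` (so `x ↦ x + t`, `A = v₂ Ш_an ↦ A + 2t`).

PROVED HERE (0 sorry): (1) every input of the «book» — MC⁻ containment, control, the Euler-system /
Kolyvagin–Rubin index pin (= x-law with ACTUAL Ш, «x-law_B»), colinearity, the digit match — is
shift-invariant, and the known UPPER half is upward-closed under the shift; (2) `Lower` fails after a
large shift; hence (3) NO satisfiable shift-invariant (or upward-closed) hypothesis family implies
`Lower` (`no_upwardClosed_family_proves_lower`) — in particular Euler-system divisibility of the
twisted elliptic unit at finite level (k3-g44 PLAN 2 (T1) read through Rubin 1991-type descent) cannot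
prove T/(a); (4) the glue `lower_of_book_of_xLawA`: book ∧ ONE weight-2 Heegner bridge (one-sided
x-law_A `2x + κ ≤ v`) ⟹ `Lower`; (5) under the ES pin the x-law_A is EQUIVALENT to `Lower`
(`xLawA_iff_lower_of_pin`): HARDEST (a) is not a waypoint weaker than the stub, it IS the stub in
value clothes; its whole content is the bridge.
-/

set_option linter.dupNamespace false

namespace Summit.BirchSwinnertonDyer.BirchSwinnertonDyer.Cruxes.SplitBadTwoLowerHalfOfFacts.HeegnerShiftK3G45

/-- The digit book of one member `W` of a Δ-key (all entries are 2-adic valuations, in `ℤ`). -/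
structure DigitModel where
  /-- `v₂ #Ш(W/K)[2^∞]` (actual Ш). -/
  B : ℤ
  /-- `v₂ [W(K) : ℤ·P]`, the Heegner index digit. -/
  i : ℤ
  /-- `v₂ (Dt.c)` (Manin-type constant of the parametrisation datum). -/
  c : ℤ
  /-- `v₂ Tam(W/K)`. -/
  tam : ℤ
  /-- `v₂ log_ω P_gen` for a generator `P_gen` of `W(K) ⊗ ℤ₂` mod torsion. -/
  ℓ : ℤ
  /-- `v₂` of the Katz value of record `∫ r·θ̂_K⁻¹ dμ`. -/
  v : ℤ
  /-- `v₂ char(X)(point)`: the main-conjecture side read at the point of record. -/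
  n : ℤ
  /-- `v₂ λ`, where the elliptic-unit class is `λ·P_gen` on the line (colinearity). -/
  lam : ℤ
  /-- control digit (local/torsion part). -/
  g : ℤ
  /-- control digit (bad-fibre part). -/
  eC : ℤ
  /-- the key constant (uniform in the Δ-key). -/
  κ : ℤ

variable (m : DigitModel)

/-- `x = v₂ log_ω y_K = i + ℓ` (`y_K = I·P_gen` up to torsion, `log_ω` additive). -/
def x : ℤ := m.i + m.ℓ

/-- The stub's conclusion in digits: `2·v₂(index) − 2·v₂(c) ≤ v₂ #Ш[2^∞] + v₂ Tam`. -/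
def Lower : Prop := 2 * m.i - 2 * m.c ≤ m.B + m.tam

/-- MC⁻ (the containment `L ∣ char X` read at the point): `v ≤ n`. -/
def MCminus : Prop := m.v ≤ m.n

/-- Control / descent: `n = B + g + eC`. -/
def Control : Prop := m.n = m.B + m.g + m.eC

/-- Euler-system / Kolyvagin–Rubin index pin with slack `r` («x-law_B»): `n − r ≤ v`. -/
def ESpin (r : ℤ) : Prop := m.n - r ≤ m.v

/-- Colinearity + explicit reciprocity reading: `v = c₁ + lam + ℓ`. -/
def Colinear (c₁ : ℤ) : Prop := m.v = c₁ + m.lam + m.ℓ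

/-- Key-uniform digit match (the plan's `α`-bookkeeping): `g + eC ≤ tam + 2c + 2ℓ + κ`. -/
def DigitMatch : Prop := m.g + m.eC ≤ m.tam + 2 * m.c + 2 * m.ℓ + m.κ

/-- The known UPPER half (Gross–Zagier–Kolyvagin) with slack `u`: `B + tam ≤ 2i − 2c + u`. -/
def Upper (u : ℤ) : Prop := m.B + m.tam ≤ 2 * m.i - 2 * m.c + u

/-- ONE-SIDED WEIGHT-2 HEEGNER BRIDGE = x-law_A: `2·x + κ ≤ v`. -/
def XLawA : Prop := 2 * x m + m.κ ≤ m.v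

/-- Two-sided bridge (Rubin/BDP-formula shape `val ≐ log_ω(y_K)²`): `v = 2x + κ`. -/
def BridgeExact : Prop := m.v = 2 * x m + m.κ

/-- The Heegner shift: only the Heegner index digit moves. -/
def shift (t : ℤ) (m : DigitModel) : DigitModel := { m with i := m.i + t }

@[simp] lemma shift_B (t : ℤ) : (shift t m).B = m.B := rfl
@[simp] lemma shift_i (t : ℤ) : (shift t m).i = m.i + t := rfl
@[simp] lemma shift_c (t : ℤ) : (shift t m).c = m.c := rfl
@[simp] lemma shift_tam (t : ℤ) : (shift t m).tam = m.tam := rfl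
@[simp] lemma shift_ℓ (t : ℤ) : (shift t m).ℓ = m.ℓ := rfl
@[simp] lemma shift_v (t : ℤ) : (shift t m).v = m.v := rfl
@[simp] lemma shift_n (t : ℤ) : (shift t m).n = m.n := rfl
@[simp] lemma shift_lam (t : ℤ) : (shift t m).lam = m.lam := rfl
@[simp] lemma shift_g (t : ℤ) : (shift t m).g = m.g := rfl
@[simp] lemma shift_eC (t : ℤ) : (shift t m).eC = m.eC := rfl
@[simp] lemma shift_κ (t : ℤ) : (shift t m).κ = m.κ := rfl

/-! ## (1) The book is shift-invariant; UPPER is upward-closed. -/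

lemma mcMinus_shift (t : ℤ) : MCminus (shift t m) ↔ MCminus m := Iff.rfl
lemma control_shift (t : ℤ) : Control (shift t m) ↔ Control m := Iff.rfl
lemma esPin_shift (t r : ℤ) : ESpin (shift t m) r ↔ ESpin m r := Iff.rfl
lemma colinear_shift (t c₁ : ℤ) : Colinear (shift t m) c₁ ↔ Colinear m c₁ := Iff.rfl
lemma digitMatch_shift (t : ℤ) : DigitMatch (shift t m) ↔ DigitMatch m := Iff.rfl

lemma upper_shift_of_nonneg {t u : ℤ} (ht : 0 ≤ t) (h : Upper m u) : Upper (shift t m) u := by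
  unfold Upper at *; simp only [shift_B, shift_tam, shift_i, shift_c]; linarith

/-! ## (2) `Lower` and x-law_A are NOT shift-invariant. -/

lemma not_lower_shift : ¬ Lower (shift (|m.B + m.tam + 2 * m.c - 2 * m.i| + 1) m) := by
  unfold Lower; simp only [shift_i, shift_c, shift_B, shift_tam]
  have := le_abs_self (m.B + m.tam + 2 * m.c - 2 * m.i)
  have h0 := abs_nonneg (m.B + m.tam + 2 * m.c - 2 * m.i)
  intro h; linarith

lemma exists_not_lower_shift : ∃ t : ℤ, 0 ≤ t ∧ ¬ Lower (shift t m) :=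
  ⟨_, by positivity, not_lower_shift m⟩

lemma not_xLawA_shift_of_xLawA : ¬ XLawA (shift (|m.v - 2 * x m - m.κ| + 1) m) := by
  unfold XLawA x; simp only [shift_i, shift_ℓ, shift_κ, shift_v]
  have := le_abs_self (m.v - 2 * (m.i + m.ℓ) - m.κ)
  have h0 := abs_nonneg (m.v - 2 * (m.i + m.ℓ) - m.κ)
  intro h; linarith

/-! ## (3) THE LINT: no satisfiable upward-closed (a fortiori shift-invariant) family proves `Lower`. -/

/-- A hypothesis family `P` on digit books is upward-closed under the Heegner shift. Every input of
the book (MC⁻, control, ES pin, colinearity, digit match: invariant) and the UPPER half (monotone)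
is of this kind; so is any conjunction of them. -/
def UpwardClosed (P : DigitModel → Prop) : Prop := ∀ m t, 0 ≤ t → P m → P (shift t m)

lemma upwardClosed_and {P Q : DigitModel → Prop} (hP : UpwardClosed P) (hQ : UpwardClosed Q) :
    UpwardClosed (fun m => P m ∧ Q m) := fun m t ht h => ⟨hP m t ht h.1, hQ m t ht h.2⟩

lemma upwardClosed_of_shiftInvariant {P : DigitModel → Prop} (h : ∀ m t, P (shift t m) ↔ P m) :
    UpwardClosed P := fun m t _ hm => (h m t).2 hm

/-- The book of record, as one family (slacks `r, c₁, u` fixed per key). -/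
def Book (r c₁ u : ℤ) (m : DigitModel) : Prop :=
  MCminus m ∧ Control m ∧ ESpin m r ∧ Colinear m c₁ ∧ DigitMatch m ∧ Upper m u

lemma book_upwardClosed (r c₁ u : ℤ) : UpwardClosed (Book r c₁ u) := by
  intro m t ht h
  rcases h with ⟨h1, h2, h3, h4, h5, h6⟩
  exact ⟨(mcMinus_shift m t).2 h1, (control_shift m t).2 h2, (esPin_shift m t r).2 h3,
    (colinear_shift m t c₁).2 h4, (digitMatch_shift m t).2 h5, upper_shift_of_nonneg m ht h6⟩

/-- **Heegner-shift lint.** A satisfiable upward-closed hypothesis family cannot imply `Lower`. -/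
theorem no_upwardClosed_family_proves_lower {P : DigitModel → Prop} (hP : UpwardClosed P)
    (m₀ : DigitModel) (h₀ : P m₀) : ¬ ∀ m, P m → Lower m := by
  intro hall
  obtain ⟨t, ht, hnot⟩ := exists_not_lower_shift m₀
  exact hnot (hall _ (hP m₀ t ht h₀))

/-- A book that is satisfied by SOME digit assignment (explicit witness). -/
def witness : DigitModel :=
  { B := 0, i := 0, c := 0, tam := 0, ℓ := 1, v := 2, n := 2, lam := 1, g := 1, eC := 1, κ := 0 }

lemma book_witness : Book 0 0 0 witness := by
  refine ⟨?_, ?_, ?_, ?_, ?_, ?_⟩ <;> simp [MCminus, Control, ESpin, Colinear, DigitMatch, Upper, witness]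

/-- **Corollary (autopsy of the Euler-system attack on T).** MC⁻ + control + the ES/Kolyvagin–Rubin
index pin + colinearity + digit match + UPPER do not imply the stub's conclusion. -/
theorem book_does_not_prove_lower : ¬ ∀ m, Book 0 0 0 m → Lower m :=
  no_upwardClosed_family_proves_lower (book_upwardClosed 0 0 0) witness book_witness

/-! ## (4) The glue with ONE weight-2 bridge, PROVED. -/

/-- `Lower ⟸ MC⁻ ∧ control ∧ digit match ∧ x-law_A` (the forced shape of every decomposition). -/
theorem lower_of_book_of_xLawA (h1 : MCminus m) (h2 : Control m) (h5 : DigitMatch m)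
    (hA : XLawA m) : Lower m := by
  unfold MCminus Control DigitMatch XLawA Lower x at *; linarith

theorem xLawA_of_bridgeExact (h : BridgeExact m) : XLawA m := by
  unfold BridgeExact XLawA at *; exact le_of_eq h.symm

/-! ## (5) Under the ES pin, x-law_A ⟺ Lower: HARDEST (a) is the stub, not a weaker waypoint. -/

theorem xLawA_iff_lower_of_pin {r : ℤ} (hpin : m.v = m.B + m.g + m.eC - r)
    (hmatch : m.g + m.eC - r = m.tam + 2 * m.c + 2 * m.ℓ + m.κ) : XLawA m ↔ Lower m := by
  unfold XLawA Lower x; constructor <;> intro h <;> linarith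

/-- The ES pin itself (two-sided Rubin formula with ACTUAL Ш) follows from the book alone. -/
theorem pin_of_book {r : ℤ} (h1 : MCminus m) (h2 : Control m) (h3 : ESpin m r) :
    m.B + m.g + m.eC - r ≤ m.v ∧ m.v ≤ m.B + m.g + m.eC := by
  unfold MCminus Control ESpin at *; constructor <;> linarith

/-! ## Weight bookkeeping: which candidate sub-stubs can carry the bridge.
A digit statement `S` has Heegner weight `w` on the useful side if `S (shift t m)` needs `v`
(or `n`, or `B`) to grow by `w·t`. `Lower` needs weight 2. Weight-1 inputs (anything linear in ONE
copy of `log_ω y_K` or in the Kummer class of `y_K`) must come in pairs. -/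

/-- A weight-1 statement (shape: «`x + κ₁ ≤ lam`», e.g. a divisibility of the Kummer image of
`y_K` relative to the elliptic-unit class). -/
def Weight1 (κ₁ : ℤ) : Prop := x m + κ₁ ≤ m.lam

/-- Two weight-1 inputs of complementary shape do give weight 2 (the only non-bridge escape; at
`p = 2` for CM both known weight-1 producers are Kolyvagin-type and barriered). -/
theorem xLawA_of_two_weight1 {κ₁ κ₂ c₁ : ℤ} (hcol : Colinear m c₁) (w1 : Weight1 m κ₁)
    (w2 : x m + κ₂ ≤ c₁ + m.ℓ) (hκ : m.κ ≤ κ₁ + κ₂) : XLawA m := by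
  unfold Colinear Weight1 XLawA x at *; linarith

end Summit.BirchSwinnertonDyer.BirchSwinnertonDyer.Cruxes.SplitBadTwoLowerHalfOfFacts.HeegnerShiftK3G45
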